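import Mathlib
import Literature.AlgebraicGeometry.Resolution.NeronPopescuSingularIdeal
import Literature.AlgebraicGeometry.Resolution.SmoothFactorizationsTransport
import HarnessLib

/-!
# Lemmas for the dévissage step `F[X] → O`, `X ↦ a` (crux `IndSmooth.ValuativeSmoothing`)

Crux `stmt-ResolutionOfSingularities-16087`, line `birth`, lead c1 dévissage programme
"discrete jumps": helper file of stub D `hasSmoothFactorizations_devissage_step`
(`IndSmoothValuativeSmoothingDevissageStep.lean`), landing the registered stub
`hasSmoothFactorizations_of_smooth_base`.

"PT holds for `R → Λ`" is the tree's `HasSmoothFactorizations R Λ`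
(`Literature/AlgebraicGeometry/Resolution/NeronPopescuSingularIdeal.lean`; Stacks, *Smoothing
Ring Maps*, text after Situation 07F2, in the factorisation form of Algebra, Lemma 07C3 (2)).
The dévissage step views a valuation ring `O` with principal maximal ideal `𝔪_O = aO`
containing a field `F` as an algebra over the PID `F[X]` through `X ↦ a` and reads PT for
`F → O` off the fibres of `F[X] → O`. This file PROVES the ingredients that do not mention the
generic fibre's target:

* `hasSmoothFactorizations_of_smooth_base` — PT descends along a smooth base extension
  `R → S`: PT for `S → Λ` gives PT for `R → Λ` (base change `A ↦ S ⊗[R] A`);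
* `DevissageStep.hasSmoothFactorizations_of_subsingleton_right` — PT for `R → 0`
  (`0 = R[1/0]` is smooth over `R`);
* `DevissageStep.isUnit_aeval_of_coeff_zero_ne_zero`, `DevissageStep.aeval_eq_pow_mul_of_ne_zero`,
  `DevissageStep.aeval_injective_of_maximalIdeal_eq` — for a local ring `O ⊇ F` with
  `𝔪_O = xO`: `q(x)` is a unit if `q(0) ≠ 0`, `q(x) = xᵐ ·` unit if `q ≠ 0`, and `x` is
  transcendental over `F` if `O` is a domain and `x ≠ 0`;
* `DevissageStep.hasSmoothFactorizations_closed_fibre` — the fibre of `F[X] → O` at `(X)` is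
  `F → O/𝔪_O` up to isomorphism of pairs, so PT transports
  (`HasSmoothFactorizations.of_ringEquiv_pair`);
* `DevissageStep.subsingleton_fibre` — the fibres at the other nonzero primes are zero;
* `DevissageStep.isLocalization_overring` — for valuation subrings `O ≤ O' = O[1/a]` of `K`,
  `O'` is the localisation of `O` at (the image of) `F[X] ∖ 0`;
* `DevissageStep.exists_ringEquiv_residueField_bot` — for `a` transcendental over an
  intermediate field `F` of `K/k`, `κ(0) = Frac F[X] ≅ F ⊔ k(a)` through `X ↦ a`.

## Sources

* The Stacks Project, *Smoothing Ring Maps* (Tag 07BW): Situation 07F2 (PT); *Algebra*,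
  Lemma 07C3. [StacksProject]
* Everything here is elementary commutative algebra. [folklore]

## Design notes

The `F[X]`-algebra structure on `O` and the `O`-algebra structure on `O'` are abstract
instances pinned down by the hypotheses `algebraMap F[X] O q = aeval x q` (`halg`) and
`(algebraMap O O' y : K) = y` (`hOO'`). Universe: `Type` throughout, as in the crux.
-/

-- single-problem summit: the doubled namespace component is forced
set_option linter.dupNamespace false

open Polynomial
open scoped TensorProduct

namespace Summit.ResolutionOfSingularities.ResolutionOfSingularities.Theorems.ValuativeSmoothing

open Literature.AlgebraicGeometry.Resolution

/-- **PT descends along a smooth base extension**: if `R → S` is smooth and PT holds for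
`S → Λ`, then PT holds for `R → Λ`. A finite type `R`-algebra `A → Λ` is base changed to the
finite type `S`-algebra `S ⊗[R] A → Λ`, which factors through a smooth `S`-algebra `C`; and `C`
is smooth over `R`. [folklore] -/
theorem hasSmoothFactorizations_of_smooth_base {R S Λ : Type} [CommRing R] [CommRing S]
    [CommRing Λ] [Algebra R S] [Algebra S Λ] [Algebra R Λ] [IsScalarTower R S Λ]
    [Algebra.Smooth R S] (h : Literature.AlgebraicGeometry.Resolution.HasSmoothFactorizations S Λ) :
    Literature.AlgebraicGeometry.Resolution.HasSmoothFactorizations R Λ := by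
  intro A _ _ hA φ
  haveI : Algebra.FiniteType R A := hA
  haveI : Algebra.FiniteType S (S ⊗[R] A) := inferInstance
  obtain ⟨C, _, _, hC, v, w, hvw⟩ := h (S ⊗[R] A) inferInstance (AlgHom.liftEquiv R S A Λ φ)
  letI : Algebra R C := ((algebraMap S C).comp (algebraMap R S)).toAlgebra
  haveI : IsScalarTower R S C := IsScalarTower.of_algebraMap_eq fun _ => rfl
  haveI : Algebra.Smooth S C := hC
  have hC' : Algebra.Smooth R C := Algebra.Smooth.comp R S C
  refine ⟨C, inferInstance, inferInstance, hC',
    (v.restrictScalars R).comp Algebra.TensorProduct.includeRight, w.restrictScalars R, ?_⟩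
  ext t
  change w (v ((1 : S) ⊗ₜ[R] t)) = φ t
  rw [← AlgHom.comp_apply, hvw, AlgHom.liftEquiv_tmul, one_smul]

namespace DevissageStep

/-! ## PT with zero target -/

/-- The zero ring is the localisation of `R` away from `0`. [folklore] -/
theorem isLocalization_away_zero_of_subsingleton (R S : Type*) [CommRing R] [CommRing S]
    [Algebra R S] [Subsingleton S] : IsLocalization.Away (0 : R) S := by
  rw [IsLocalization.Away, isLocalization_iff]
  exact ⟨fun _ => isUnit_of_subsingleton _, fun z => ⟨(0, 1), Subsingleton.elim _ _⟩,
    fun {x y} _ => ⟨⟨0, Submonoid.mem_powers 0⟩, by simp⟩⟩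

/-- PT holds trivially for `R → 0`: the zero ring `0 = R[1/0]` is smooth over `R`, and every
`A → 0` factors through it. [folklore] -/
theorem hasSmoothFactorizations_of_subsingleton_right (R Λ : Type) [CommRing R] [CommRing Λ]
    [Algebra R Λ] [Subsingleton Λ] : HasSmoothFactorizations R Λ := by
  intro A _ _ _ φ
  haveI : IsLocalization.Away (0 : R) Λ := isLocalization_away_zero_of_subsingleton R Λ
  haveI : Algebra.Smooth R Λ := Algebra.Smooth.of_isLocalization_Away 0
  exact ⟨Λ, inferInstance, inferInstance, inferInstance, φ, AlgHom.id R Λ, AlgHom.id_comp φ⟩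

/-! ## Units and transcendence: `F[X] → O`, `X ↦ x`, for a local ring with `𝔪_O = xO ⊇ F` -/

section LocalUnits

variable {O F : Type} [CommRing O] [IsLocalRing O] [Field F] [Algebra F O] (x : O)

omit [Algebra F O] in
/-- In a local ring, a unit plus an element of the maximal ideal is a unit. [folklore] -/
theorem isUnit_add_of_mem_maximalIdeal {u m : O} (hu : IsUnit u)
    (hm : m ∈ IsLocalRing.maximalIdeal O) : IsUnit (u + m) := by
  by_contra h
  have h' : u + m ∈ IsLocalRing.maximalIdeal O := (IsLocalRing.mem_maximalIdeal _).mpr h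
  have hu' : u ∈ IsLocalRing.maximalIdeal O := by
    simpa using Ideal.sub_mem _ h' hm
  exact IsLocalRing.notMem_maximalIdeal.mpr hu hu'

/-- If `𝔪_O = xO` and `F ⊆ O` is a field, a polynomial `q ∈ F[X]` with `q(0) ≠ 0` evaluates
at `x` to a unit of `O`: `q(x) = q(0) + (…) · x`. [folklore] -/
theorem isUnit_aeval_of_coeff_zero_ne_zero
    (hmax : IsLocalRing.maximalIdeal O = Ideal.span {x}) (q : F[X]) (hq : q.coeff 0 ≠ 0) :
    IsUnit (aeval x q) := by
  have hq' : aeval x q = algebraMap F O (q.coeff 0) + aeval x (divX q) * x := by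
    conv_lhs => rw [← divX_mul_X_add q]
    rw [map_add, map_mul, aeval_X, aeval_C, add_comm]
  rw [hq']
  refine isUnit_add_of_mem_maximalIdeal ((IsUnit.mk0 _ hq).map _) ?_
  rw [hmax]
  exact Ideal.mul_mem_left _ _ (Ideal.mem_span_singleton_self x)

/-- If `𝔪_O = xO` and `F ⊆ O` is a field, every nonzero `q ∈ F[X]` evaluates at `x` to
`x ^ m · u` with `u` a unit of `O` (write `q = X ^ m q₁` with `q₁(0) ≠ 0`). [folklore] -/
theorem aeval_eq_pow_mul_of_ne_zero
    (hmax : IsLocalRing.maximalIdeal O = Ideal.span {x}) (q : F[X]) (hq : q ≠ 0) :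
    ∃ (m : ℕ) (u : O), IsUnit u ∧ aeval x q = x ^ m * u := by
  obtain ⟨q₁, hq₁, hdvd⟩ := exists_eq_pow_rootMultiplicity_mul_and_not_dvd q hq 0
  rw [map_zero, sub_zero] at hq₁ hdvd
  rw [X_dvd_iff] at hdvd
  refine ⟨q.rootMultiplicity 0, aeval x q₁, isUnit_aeval_of_coeff_zero_ne_zero x hmax q₁ hdvd, ?_⟩
  conv_lhs => rw [hq₁]
  rw [map_mul, map_pow, aeval_X]

/-- If `𝔪_O = xO` with `x ≠ 0` in a local domain `O` containing the field `F`, then `x` is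
transcendental over `F`: `F[X] → O`, `X ↦ x`, is injective. [folklore] -/
theorem aeval_injective_of_maximalIdeal_eq [IsDomain O]
    (hmax : IsLocalRing.maximalIdeal O = Ideal.span {x}) (hx : x ≠ 0) :
    Function.Injective (aeval x : F[X] →ₐ[F] O) := by
  rw [injective_iff_map_eq_zero]
  intro q hq
  by_contra hq0
  obtain ⟨m, u, hu, h⟩ := aeval_eq_pow_mul_of_ne_zero x hmax q hq0
  rw [hq] at h
  rcases mul_eq_zero.mp h.symm with h1 | h1
  · exact hx (eq_zero_of_pow_eq_zero h1)
  · exact hu.ne_zero h1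

end LocalUnits

/-! ## The fibres of `F[X] → O` at the nonzero primes -/

section SpecialFibres

variable {O F : Type} [CommRing O] [IsLocalRing O] [Field F] [Algebra F O] [Algebra F[X] O]

/-- A prime of `F[X]` containing `X` is `(X)`. [folklore] -/
theorem eq_span_X_of_X_mem (p : Ideal F[X]) [p.IsPrime] (hXp : X ∈ p) : p = Ideal.span {X} :=
  ((PrincipalIdealRing.isMaximal_of_irreducible irreducible_X).eq_of_le
    (Ideal.IsPrime.ne_top ‹_›) ((Ideal.span_singleton_le_iff_mem _).mpr hXp)).symm

/-- For a prime `p ∋ X` of `F[X]`, the composite `F → F[X] → κ(p)` is bijective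
(`κ((X)) = F[X]/(X) = F`). [folklore] -/
theorem algebraMap_residueField_comp_C_bijective (p : Ideal F[X]) [p.IsPrime] (hXp : X ∈ p) :
    Function.Bijective ((algebraMap F[X] p.ResidueField).comp C) := by
  haveI : p.IsMaximal := eq_span_X_of_X_mem p hXp ▸
    PrincipalIdealRing.isMaximal_of_irreducible irreducible_X
  refine ⟨RingHom.injective _, fun z => ?_⟩
  obtain ⟨q, rfl⟩ := Ideal.algebraMap_residueField_surjective p z
  refine ⟨q.coeff 0, ?_⟩
  rw [RingHom.comp_apply, eq_comm, ← sub_eq_zero, ← map_sub, Ideal.algebraMap_residueField_eq_zero,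
    ← eq_sub_of_add_eq (divX_mul_X_add q)]
  exact Ideal.mul_mem_left _ _ hXp

/-- **The closed fibre.** If `𝔪_O = xO`, `F[X] → O` sends `X ↦ x` and `p ∋ X` is a prime of
`F[X]`, then the fibre `κ(p) → κ(p) ⊗[F[X]] O` is isomorphic to `F → O/𝔪_O` (as
`κ(p) = F[X]/(X) = F` and `F[X]/(X) ⊗[F[X]] O = O/xO`), so PT for `F → O/𝔪_O` gives PT for
the fibre. [folklore] -/
theorem hasSmoothFactorizations_closed_fibre [IsScalarTower F F[X] O]
    [Algebra F (IsLocalRing.ResidueField O)] [IsScalarTower F O (IsLocalRing.ResidueField O)]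
    {x : O} (hmax : IsLocalRing.maximalIdeal O = Ideal.span {x}) (hX : algebraMap F[X] O X = x)
    (p : Ideal F[X]) [p.IsPrime] (hXp : X ∈ p)
    (h1 : HasSmoothFactorizations F (IsLocalRing.ResidueField O)) :
    HasSmoothFactorizations p.ResidueField (p.ResidueField ⊗[F[X]] O) := by
  have hpX : p = Ideal.span {X} := eq_span_X_of_X_mem p hXp
  haveI : p.IsMaximal := hpX ▸ PrincipalIdealRing.isMaximal_of_irreducible irreducible_X
  have hmap : p.map (algebraMap F[X] O) = IsLocalRing.maximalIdeal O := by
    rw [hpX, Ideal.map_span, Set.image_singleton, hX, hmax]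
  -- the base `F ≅ κ(p)`
  let eR : F ≃+* p.ResidueField :=
    RingEquiv.ofBijective _ (algebraMap_residueField_comp_C_bijective p hXp)
  -- the target `O/𝔪_O ≅ O/pO ≅ F[X]/p ⊗ O ≅ κ(p) ⊗ O`
  let e1 : (F[X] ⧸ p) ≃ₐ[F[X]] p.ResidueField :=
    AlgEquiv.ofBijective (IsScalarTower.toAlgHom F[X] (F[X] ⧸ p) p.ResidueField)
      (Ideal.bijective_algebraMap_quotient_residueField p)
  let e2 : (F[X] ⧸ p) ⊗[F[X]] O ≃ₐ[F[X]] p.ResidueField ⊗[F[X]] O :=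
    Algebra.TensorProduct.congr e1 AlgEquiv.refl
  let e3 : (O ⧸ p.map (algebraMap F[X] O)) ≃+* (F[X] ⧸ p) ⊗[F[X]] O :=
    (Algebra.TensorProduct.quotIdealMapEquivQuotTensor O p).toRingEquiv
  let e4 : IsLocalRing.ResidueField O ≃+* O ⧸ p.map (algebraMap F[X] O) :=
    Ideal.quotEquivOfEq hmap.symm
  let eΛ : IsLocalRing.ResidueField O ≃+* p.ResidueField ⊗[F[X]] O :=
    e4.trans (e3.trans e2.toRingEquiv)
  refine h1.of_ringEquiv_pair eR eΛ fun c => ?_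
  have hL : algebraMap F (IsLocalRing.ResidueField O) c =
      IsLocalRing.residue O (algebraMap F O c) :=
    IsScalarTower.algebraMap_apply F O _ c
  have h4 : e4 (IsLocalRing.residue O (algebraMap F O c)) =
      Ideal.Quotient.mk _ (algebraMap F O c) :=
    Ideal.quotEquivOfEq_mk _ _
  have hR : (eR c : p.ResidueField) = algebraMap F[X] p.ResidueField (C c) := rfl
  rw [hL, hR, Algebra.TensorProduct.algebraMap_apply, Algebra.algebraMap_self, RingHom.id_apply,
    ← Algebra.TensorProduct.algebraMap_apply (R := F[X]) (S := F[X]) (A := p.ResidueField),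
    Algebra.TensorProduct.algebraMap_apply', ← Polynomial.algebraMap_eq (R := F),
    ← IsScalarTower.algebraMap_apply F F[X] O c]
  change e2 (e3 (e4 (IsLocalRing.residue O (algebraMap F O c)))) = _
  rw [h4]
  change e2 (Algebra.TensorProduct.quotIdealMapEquivQuotTensor O p
    (Ideal.Quotient.mk _ (algebraMap F O c))) = _
  rw [Algebra.TensorProduct.quotIdealMapEquivQuotTensor_mk, Algebra.TensorProduct.congr_apply,
    Algebra.TensorProduct.map_tmul, map_one]
  rfl

/-- **The other closed fibres are empty.** If `𝔪_O = xO`, `F[X] → O` sends `X ↦ x` and `p` is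
a nonzero prime of `F[X]` not containing `X`, then `κ(p) ⊗[F[X]] O = 0`: `p` contains some
`q₁` with `q₁(0) ≠ 0`, and `q₁ ↦ 0` in `κ(p)` while `q₁(x)` is a unit of `O`. [folklore] -/
theorem subsingleton_fibre {x : O} (hmax : IsLocalRing.maximalIdeal O = Ideal.span {x})
    (halg : ∀ q : F[X], algebraMap F[X] O q = aeval x q)
    (p : Ideal F[X]) [p.IsPrime] (hp0 : p ≠ ⊥) (hXp : X ∉ p) :
    Subsingleton (p.ResidueField ⊗[F[X]] O) := by
  obtain ⟨q, hqp, hq0⟩ := Submodule.exists_mem_ne_zero_of_ne_bot hp0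
  obtain ⟨q₁, hq₁, hdvd⟩ := exists_eq_pow_rootMultiplicity_mul_and_not_dvd q hq0 0
  rw [map_zero, sub_zero] at hq₁ hdvd
  rw [X_dvd_iff] at hdvd
  have hq₁p : q₁ ∈ p := by
    rw [hq₁] at hqp
    rcases ‹p.IsPrime›.mem_or_mem hqp with h | h
    · exact absurd (‹p.IsPrime›.mem_of_pow_mem _ h) hXp
    · exact h
  have hu : IsUnit (algebraMap F[X] O q₁) := by
    rw [halg]
    exact isUnit_aeval_of_coeff_zero_ne_zero x hmax q₁ hdvd
  obtain ⟨u, hu'⟩ := hu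
  have h2 : (1 : p.ResidueField) ⊗ₜ[F[X]] (algebraMap F[X] O q₁) = 0 := by
    rw [Algebra.algebraMap_eq_smul_one, ← TensorProduct.smul_tmul,
      ← Algebra.algebraMap_eq_smul_one, Ideal.algebraMap_residueField_eq_zero.mpr hq₁p,
      TensorProduct.zero_tmul]
  refine subsingleton_of_zero_eq_one (Eq.symm ?_)
  calc (1 : p.ResidueField ⊗[F[X]] O)
        = ((1 : p.ResidueField) ⊗ₜ[F[X]] (↑u⁻¹ : O)) * (1 ⊗ₜ[F[X]] (↑u : O)) := by
          rw [Algebra.TensorProduct.tmul_mul_tmul, one_mul, Units.inv_mul]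
          rfl
    _ = 0 := by rw [hu', h2, mul_zero]

end SpecialFibres

/-! ## The overring `O' = O[1/a]` is the localisation of `O` at `F[X] ∖ 0` -/

section Overring

variable {K : Type} [Field K] {O O' : ValuationSubring K} {F : Type} [Field F] [Algebra F O]
  [Algebra F[X] O] [Algebra O O'] {a : K} (ha : a ∈ O)

/-- If `𝔪_O = aO` with `a ≠ 0`, `F ⊆ O` is a field, `F[X] → O` sends `X ↦ a` and
`O' = {z | aⁿ z ∈ O for some n} ⊇ O`, then `O'` is the localisation of `O` at the image of
`F[X] ∖ 0`: every `q(a)`, `q ≠ 0`, is `aᵐ ·` unit, and `a` is invertible in `O'`. [folklore] -/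
theorem isLocalization_overring (ha0 : a ≠ 0)
    (hmax : IsLocalRing.maximalIdeal O = Ideal.span {(⟨a, ha⟩ : O)})
    (hO' : ∀ x : K, x ∈ O' ↔ ∃ n : ℕ, a ^ n * x ∈ O)
    (halg : ∀ q : F[X], algebraMap F[X] O q = aeval (⟨a, ha⟩ : O) q)
    (hOO' : ∀ y : O, (algebraMap O O' y : K) = y) :
    IsLocalization (Algebra.algebraMapSubmonoid O (nonZeroDivisors F[X])) O' := by
  set x : O := ⟨a, ha⟩ with hxdef
  have hinjOO' : Function.Injective (algebraMap O O') := fun y₁ y₂ h =>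
    Subtype.ext (by rw [← hOO' y₁, ← hOO' y₂, h])
  have hainv : a⁻¹ ∈ O' :=
    (hO' a⁻¹).mpr ⟨1, by rw [pow_one, mul_inv_cancel₀ ha0]; exact O.one_mem⟩
  have hxunit : IsUnit (algebraMap O O' x) :=
    isUnit_iff_exists_inv.mpr ⟨⟨a⁻¹, hainv⟩, Subtype.ext (by
      rw [MulMemClass.coe_mul, hOO' x, OneMemClass.coe_one]
      exact mul_inv_cancel₀ ha0)⟩
  rw [isLocalization_iff]
  refine ⟨?_, ?_, ?_⟩
  · rintro ⟨y, q, hq, rfl⟩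
    have hq0 : q ≠ 0 := nonZeroDivisors.ne_zero hq
    obtain ⟨m, u, hu, h⟩ := aeval_eq_pow_mul_of_ne_zero x hmax q hq0
    change IsUnit (algebraMap O O' (algebraMap F[X] O q))
    rw [halg, h, map_mul, map_pow]
    exact (hxunit.pow m).mul (hu.map _)
  · intro z
    obtain ⟨n, hn⟩ := (hO' z).mp z.2
    let s : Algebra.algebraMapSubmonoid O (nonZeroDivisors F[X]) :=
      ⟨algebraMap F[X] O (X ^ n), Algebra.mem_algebraMapSubmonoid_of_mem
        ⟨X ^ n, pow_mem (mem_nonZeroDivisors_of_ne_zero X_ne_zero) n⟩⟩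
    refine ⟨(⟨a ^ n * z, hn⟩, s), Subtype.ext ?_⟩
    change (z : K) * (algebraMap O O' (algebraMap F[X] O (X ^ n)) : K) =
      (algebraMap O O' ⟨a ^ n * z, hn⟩ : K)
    rw [hOO', hOO', halg, map_pow, aeval_X, SubmonoidClass.coe_pow]
    exact mul_comm _ _
  · intro y₁ y₂ h
    exact ⟨1, by rw [hinjOO' h]⟩

end Overring

/-! ## The field `F(a) = F ⊔ k(a)` as the residue field of `F[X]` at `0` -/

section GenericField

variable {k K : Type} [Field k] [Field K] [Algebra k K] (F F' : IntermediateField k K) (a : K)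

/-- If `F ≤ F'` and `a ∈ F'` then `q(a) ∈ F'` for every `q ∈ F[X]`. [folklore] -/
theorem aeval_mem_of_le (hFF' : F ≤ F') (haF' : a ∈ F') (p : F[X]) : aeval a p ∈ F' := by
  refine p.induction_on (fun c => ?_) (fun p q hp hq => ?_) (fun n c h => ?_)
  · rw [aeval_C]
    exact hFF' c.2
  · rw [map_add]
    exact add_mem hp hq
  · rw [pow_succ, ← mul_assoc, map_mul, aeval_X]
    exact mul_mem h haF'

/-- If `a ∈ K` is transcendental over the intermediate field `F` of `K/k`, then evaluation at
`a` identifies the residue field `κ(0) = Frac F[X]` of `F[X]` at the zero ideal with the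
intermediate field `F(a) = F ⊔ k(a)`. [folklore] -/
theorem exists_ringEquiv_residueField_bot
    (hinj : Function.Injective (aeval a : F[X] →ₐ[F] K))
    (hF' : F' = F ⊔ IntermediateField.adjoin k {a}) :
    ∃ e : (⊥ : Ideal F[X]).ResidueField ≃+* F',
      ∀ q : F[X], (e (algebraMap F[X] _ q) : K) = aeval a q := by
  have hg : Function.Injective (aeval a : F[X] →ₐ[F] K).toRingHom := hinj
  have hf : ∀ q, IsFractionRing.lift (K := (⊥ : Ideal F[X]).ResidueField) hg
      (algebraMap F[X] _ q) = aeval a q :=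
    fun q => IsFractionRing.lift_algebraMap hg q
  set f : (⊥ : Ideal F[X]).ResidueField →+* K := IsFractionRing.lift hg with hfdef
  have hFF' : F ≤ F' := by
    rw [hF']
    exact le_sup_left
  have haF' : a ∈ F' := by
    rw [hF']
    exact (le_sup_right : IntermediateField.adjoin k {a} ≤ F ⊔ IntermediateField.adjoin k {a})
      (IntermediateField.subset_adjoin k {a} rfl)
  have hmem : ∀ z, f z ∈ F' := by
    intro z
    obtain ⟨p, q, _, rfl⟩ := IsFractionRing.div_surjective (A := F[X]) z
    rw [map_div₀, hf, hf]
    exact div_mem (aeval_mem_of_le F F' a hFF' haF' p) (aeval_mem_of_le F F' a hFF' haF' q)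
  -- the range of `f`, as an intermediate field, contains `F` and `a`, hence `F'`
  let T : IntermediateField k K := f.fieldRange.toIntermediateField fun c =>
    ⟨algebraMap F[X] _ (C ⟨algebraMap k K c, F.algebraMap_mem c⟩), by rw [hf, aeval_C]; rfl⟩
  have hFT : F ≤ T := fun y hy => ⟨algebraMap F[X] _ (C ⟨y, hy⟩), by rw [hf, aeval_C]; rfl⟩
  have haT : a ∈ T := ⟨algebraMap F[X] _ X, by rw [hf, aeval_X]⟩
  have hF'T : F' ≤ T := by
    rw [hF']
    exact sup_le hFT (IntermediateField.adjoin_le_iff.mpr (Set.singleton_subset_iff.mpr haT))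
  have hsurj : Function.Surjective (f.codRestrict F' hmem) := by
    rintro ⟨y, hy⟩
    obtain ⟨z, hz⟩ := (hF'T hy : y ∈ f.fieldRange)
    exact ⟨z, Subtype.ext hz⟩
  exact ⟨RingEquiv.ofBijective (f.codRestrict F' hmem) ⟨RingHom.injective _, hsurj⟩,
    fun q => hf q⟩

end GenericField

end DevissageStep

end Summit.ResolutionOfSingularities.ResolutionOfSingularities.Theorems.ValuativeSmoothing
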